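import Literature.Probability.LatticeModels.VillainCurrentModel
import Literature.Probability.LatticeModels.VillainWormRepresentation
import Literature.Probability.LatticeModels.VillainPinnedMonotonicity
import HarnessLib

/-!
# The Villain current model is the worm representation of the Villain rotator:
# `VillainCurrentModel.twoPoint = ofReal villainTwoPoint`, and Ginibre monotonicity in the stiffness

The bondwise-stiffness Villain integer-current model `VillainCurrentModel d L M` of
`VillainCurrentModel.lean` (space-time torus `(ℤ/Lℤ)^d × ℤ/Mℤ`, weights `∏_b e^{-J_b²/(2κ_b)}` on
integer currents with prescribed divergence, worm two-point function
`twoPoint P x y = Z(δ_x − δ_y)/Z(0) ∈ ℝ≥0∞`) and the angle-side Villain two-point function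
`villainTwoPoint s t κ x y = ⟨cos(θ_x − θ_y)⟩_κ` of `VillainMonotonicity.lean` live on the same
multigraph: vertices `SpaceTimeSite d L M`, edges `Bond d L M`, the bond `b = (s, μ)` running
from `s` to `s + e_μ`. This file records the dictionary and its first consequence:

* `JCurrent.sum_bond_indicator_mul_eq_neg_div` — Kirchhoff's form of the divergence:
  `∑_b ([b.1 + e_{b.2} = v] − [b.1 = v]) J_b = −(div J)(v)`;
* `VillainCurrentModel.currentSum_eq_ofReal_tsum` — `Z(ρ)` is `ofReal` of the real current sum
  written with that Kirchhoff condition;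
* **`VillainCurrentModel.twoPoint_eq_ofReal_villainTwoPoint`** — the duality
  `twoPoint P x y = ofReal ⟨cos(θ_x − θ_y)⟩_{κ = P.stiffness}` (Wallin et al. 1994 §II;
  Fröhlich–Spencer 1982 §2), an instance of the tree's PROVED worm representation
  `villainTwoPoint_eq_currentSum_div` (`VillainWormRepresentation.lean`);
* `villainTwoPoint_congr_of_loops` — loop edges (`s e = t e`) contribute constant factors
  `v_κ(0)` to the Gibbs weight, so `⟨cos(θ_x − θ_y)⟩` does not depend on their stiffness
  (used for the one-time-slice models `M = 1`, whose temporal bonds are loops);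
* **`VillainCurrentModel.twoPoint_mono`** — Ginibre monotonicity on the current side: if
  `P.stiffness ≤ Q.stiffness` bondwise then `P.twoPoint x y ≤ Q.twoPoint x y` for all space-time
  sites (Aizenman–Harel–Peled–Shapiro 2021, Cor. 11.4, PROVED in the tree for arbitrary finite
  multigraphs as `pinnedVillainTwoPoint_mono`).

Everything is PROVED; no definition and no named fact is introduced.

## References

* [WallinEtAl1994] M. Wallin, E. Sørensen, S. Girvin, A. P. Young, Phys. Rev. B 49 (1994) 12115,
  §II (integer-current representation of Villain rotors).
* [FrohlichSpencerCMP1982] J. Fröhlich, T. Spencer, Comm. Math. Phys. 83 (1982) 411–454, §2.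
* [AizenmanHarelPeledShapiro2021] M. Aizenman, M. Harel, R. Peled, J. Shapiro, arXiv:2110.09498,
  §11.3, Cor. 11.4.
-/

noncomputable section

open MeasureTheory Finset Filter
open scoped ENNReal BigOperators

namespace Literature.Probability.LatticeModels

open Literature.MathematicalPhysics.QuantumFieldTheory

/-! ### Loop edges do not matter for the angle-side two-point function -/

section Loops

variable {V ι : Type*} [Fintype V] [Fintype ι]

/-- On a finite multigraph, two stiffness fields that agree on every edge which is NOT a loop
(`s e ≠ t e`) have the same Villain two-point function: a loop `e` contributes the constant
factor `v_{κ_e}(θ_{s e} − θ_{s e}) = v_{κ_e}(0) > 0` to the Gibbs weight, which cancels in the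
ratio `⟨cos(θ_x − θ_y)⟩ = (∫ cos · W)/(∫ W)`. [folklore] -/
theorem villainTwoPoint_congr_of_loops (s t : ι → V) {κ κ' : ι → ℝ} (hκ : ∀ e, 0 < κ e)
    (hκ' : ∀ e, 0 < κ' e) (h : ∀ e, s e ≠ t e → κ e = κ' e) (x y : V) :
    villainTwoPoint s t κ x y = villainTwoPoint s t κ' x y := by
  classical
  set C : ℝ := ∏ e ∈ Finset.univ.filter (fun e => s e = t e), villainKernel (κ e) 0 with hCdef
  set C' : ℝ := ∏ e ∈ Finset.univ.filter (fun e => s e = t e), villainKernel (κ' e) 0 with hC'def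
  have hC : 0 < C := Finset.prod_pos fun e _ => villainKernel_pos (hκ e) 0
  have hC' : 0 < C' := Finset.prod_pos fun e _ => villainKernel_pos (hκ' e) 0
  -- loops give constant factors, non-loops carry the same stiffness
  have hl : ∀ (k : ι → ℝ) (θ : V → ℝ),
      ∏ e ∈ Finset.univ.filter (fun e => s e = t e), villainKernel (k e) (θ (t e) - θ (s e)) =
        ∏ e ∈ Finset.univ.filter (fun e => s e = t e), villainKernel (k e) 0 := fun k θ =>
    Finset.prod_congr rfl fun e he => by rw [(Finset.mem_filter.1 he).2, sub_self]
  have hn : ∀ θ : V → ℝ,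
      ∏ e ∈ Finset.univ.filter (fun e => ¬ s e = t e), villainKernel (κ e) (θ (t e) - θ (s e)) =
        ∏ e ∈ Finset.univ.filter (fun e => ¬ s e = t e), villainKernel (κ' e) (θ (t e) - θ (s e)) :=
    fun θ => Finset.prod_congr rfl fun e he => by rw [h e (Finset.mem_filter.1 he).2]
  have hW : ∀ θ : V → ℝ, villainSpinWeight s t κ θ * C' = villainSpinWeight s t κ' θ * C := by
    intro θ
    simp only [villainSpinWeight]
    rw [← Finset.prod_filter_mul_prod_filter_not Finset.univ (fun e => s e = t e)
        (fun e => villainKernel (κ e) (θ (t e) - θ (s e))),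
      ← Finset.prod_filter_mul_prod_filter_not Finset.univ (fun e => s e = t e)
        (fun e => villainKernel (κ' e) (θ (t e) - θ (s e))), hl κ, hl κ', hn θ, hCdef, hC'def]
    ring
  unfold villainTwoPoint
  rw [← mul_div_mul_right _ _ hC'.ne', ← integral_mul_const, ← integral_mul_const]
  simp_rw [mul_assoc, hW, ← mul_assoc]
  rw [integral_mul_const, integral_mul_const, mul_div_mul_right _ _ hC.ne']

end Loops

/-! ### Kirchhoff's form of the divergence on the space-time torus -/

namespace JCurrent

variable {d L M : ℕ} [NeZero L] [NeZero M]

/-- Kirchhoff's form of the lattice divergence: summing `J` over the bonds entering `v` minus the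
bonds leaving `v`, `∑_b ([b.1 + e_{b.2} = v] − [b.1 = v]) J_b = −(div J)(v)` (the bond `(s, μ)` runs
from `s` to `s + e_μ`; `div` = outflow minus inflow). [folklore] -/
theorem sum_bond_indicator_mul_eq_neg_div (J : Config d L M) (v : SpaceTimeSite d L M) :
    ∑ b : Bond d L M, ((if b.1 + unitVec b.2 = v then (1 : ℤ) else 0) - (if b.1 = v then 1 else 0)) * J b =
      -div J v := by
  rw [Fintype.sum_prod_type, Finset.sum_comm, div, ← Finset.sum_neg_distrib]
  refine Finset.sum_congr rfl fun μ _ => ?_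
  simp only [sub_mul, ite_mul, one_mul, zero_mul, Finset.sum_sub_distrib]
  have h1 : ∑ s : SpaceTimeSite d L M, (if s + unitVec μ = v then J (s, μ) else 0) =
      J (v - unitVec μ, μ) := by
    have he : ∀ s : SpaceTimeSite d L M, (s + unitVec μ = v) = (s = v - unitVec μ) := fun s =>
      propext eq_sub_iff_add_eq.symm
    simp_rw [he]
    rw [Finset.sum_ite_eq' Finset.univ (v - unitVec μ) (fun s => J (s, μ)), if_pos (Finset.mem_univ _)]
  have h2 : ∑ s : SpaceTimeSite d L M, (if s = v then J (s, μ) else 0) = J (v, μ) := by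
    rw [Finset.sum_ite_eq' Finset.univ v (fun s => J (s, μ)), if_pos (Finset.mem_univ _)]
  rw [h1, h2]
  ring

/-- Hence the Kirchhoff condition with source `ρ` is the divergence condition `div J = ρ`:
`(∀ v, ρ v + ∑_b ([b.1 + e_{b.2} = v] − [b.1 = v]) J_b = 0) ↔ div J = ρ`. [folklore] -/
theorem kirchhoff_iff_div_eq (J : Config d L M) (ρ : SpaceTimeSite d L M → ℤ) :
    (∀ v, ρ v + ∑ b : Bond d L M,
        ((if b.1 + unitVec b.2 = v then (1 : ℤ) else 0) - (if b.1 = v then 1 else 0)) * J b = 0) ↔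
      div J = ρ := by
  simp only [sum_bond_indicator_mul_eq_neg_div, funext_iff]
  refine forall_congr' fun v => ?_
  constructor <;> intro hv <;> linarith

end JCurrent

/-! ### The dictionary `twoPoint = ofReal villainTwoPoint` and monotonicity -/

namespace VillainCurrentModel

open JCurrent PositiveCurrentModel

variable {d L M : ℕ} [NeZero L] [NeZero M] (P : VillainCurrentModel d L M)

/-- Every current sum of the `ℝ≥0∞`-valued model is `ofReal` of the real-valued current sum written
with the Kirchhoff condition: for any decidable predicate `p` equivalent to `div J = ρ`,
`ofReal (∑_J [p J] ∏_b e^{-J_b²/(2κ_b)}) = Z(ρ)`. [folklore] -/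
theorem ofReal_tsum_ite_eq_currentSum (ρ : SpaceTimeSite d L M → ℤ) (p : Config d L M → Prop)
    [DecidablePred p] (hp : ∀ J, p J ↔ div J = ρ) :
    ENNReal.ofReal (∑' J : Config d L M,
        if p J then ∏ b, Real.exp (-((J b : ℝ) ^ 2) / (2 * P.stiffness b)) else 0) =
      P.currentSum ρ := by
  classical
  have hw : ∀ J : Config d L M,
      (∏ b, Real.exp (-((J b : ℝ) ^ 2) / (2 * P.stiffness b))) =
        ∏ b, villainCurrentWeight (P.stiffness b) (J b) := fun J => rfl
  have h0 : ∀ J : Config d L M, 0 ≤ ∏ b, villainCurrentWeight (P.stiffness b) (J b) := fun J =>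
    Finset.prod_nonneg fun b _ => (villainCurrentWeight_pos _ _).le
  have hs : Summable fun J : Config d L M => ∏ b, villainCurrentWeight (P.stiffness b) (J b) :=
    summable_pi_prod_of_summable' (fun b : Bond d L M => villainCurrentWeight (P.stiffness b))
      (fun b n => (villainCurrentWeight_pos _ n).le)
      fun b => summable_villainCurrentWeight (P.stiffness_pos b)
  simp_rw [hw]
  have h0' : ∀ J : Config d L M,
      0 ≤ (if p J then ∏ b, villainCurrentWeight (P.stiffness b) (J b) else 0) := fun J => by
    split_ifs
    · exact h0 J
    · exact le_rfl
  have hs' : Summable fun J : Config d L M =>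
      (if p J then ∏ b, villainCurrentWeight (P.stiffness b) (J b) else 0) :=
    hs.of_nonneg_of_le h0' fun J => by
      split_ifs
      · exact le_rfl
      · exact h0 J
  rw [ENNReal.ofReal_tsum_of_nonneg h0' hs']
  unfold currentSum
  refine tsum_congr fun J => ?_
  by_cases hJ : div J = ρ
  · rw [if_pos ((hp J).2 hJ), if_pos hJ, weight_eq_ofReal_prod]
  · rw [if_neg (fun h => hJ ((hp J).1 h)), if_neg hJ, ENNReal.ofReal_zero]

/-- **Duality: the current model is the worm representation of the Villain rotator.** For every
bondwise stiffness field and all space-time sites `x, y`,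
`twoPoint P x y = ofReal ⟨cos(θ_x − θ_y)⟩_κ`, the angle-side two-point function
(`villainTwoPoint`) of the Villain rotator on the multigraph of the space-time torus (edge
`b = (s, μ)` from `s` to `s + e_μ`, stiffness `κ_b = P.stiffness b`). An instance of the tree's
proved worm representation `villainTwoPoint_eq_currentSum_div` (Fourier/Poisson duality on each
edge). [cite: WallinEtAl1994, §II] -/
theorem twoPoint_eq_ofReal_villainTwoPoint (x y : SpaceTimeSite d L M) :
    P.twoPoint x y = ENNReal.ofReal
      (villainTwoPoint (Prod.fst : Bond d L M → SpaceTimeSite d L M)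
        (fun b => b.1 + unitVec b.2) P.stiffness x y) := by
  classical
  rw [villainTwoPoint_eq_currentSum_div Prod.fst (fun b : Bond d L M => b.1 + unitVec b.2)
    P.stiffness_pos x y]
  -- the denominator is the partition function, in particular positive
  have hden := P.ofReal_tsum_ite_eq_currentSum 0
    (fun J : Config d L M => ∀ v : SpaceTimeSite d L M, ∑ b : Bond d L M,
      ((if b.1 + unitVec b.2 = v then (1 : ℤ) else 0) - (if b.1 = v then 1 else 0)) * J b = 0)
    (fun J => by simpa using kirchhoff_iff_div_eq J 0)
  have hnum := P.ofReal_tsum_ite_eq_currentSum (Pi.single x 1 - Pi.single y 1)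
    (fun J : Config d L M => ∀ v : SpaceTimeSite d L M,
      ((if x = v then (1 : ℤ) else 0) - (if y = v then 1 else 0)) + ∑ b : Bond d L M,
        ((if b.1 + unitVec b.2 = v then (1 : ℤ) else 0) - (if b.1 = v then 1 else 0)) * J b = 0)
    (fun J => by
      rw [← kirchhoff_iff_div_eq J]
      refine forall_congr' fun v => ?_
      simp only [Pi.sub_apply, Pi.single_apply, eq_comm])
  have hpos : 0 < ∑' J : Config d L M,
      if (∀ v : SpaceTimeSite d L M, ∑ b : Bond d L M,
          ((if b.1 + unitVec b.2 = v then (1 : ℤ) else 0) - (if b.1 = v then 1 else 0)) * J b = 0)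
      then ∏ b, Real.exp (-((J b : ℝ) ^ 2) / (2 * P.stiffness b)) else 0 := by
    have h1 : (1 : ℝ≥0∞) ≤ P.currentSum 0 := P.one_le_partitionFunction
    rw [← hden, ENNReal.one_le_ofReal] at h1
    linarith
  rw [ENNReal.ofReal_div_of_pos hpos, hnum, hden]
  rfl

/-- **Ginibre monotonicity on the current side (Aizenman–Harel–Peled–Shapiro 2021, Cor. 11.4, in
the worm representation).** If `P.stiffness b ≤ Q.stiffness b` on every bond of the space-time
torus then `P.twoPoint x y ≤ Q.twoPoint x y` for all space-time sites: raising any stiffness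
raises every worm two-point function. By duality (`twoPoint_eq_ofReal_villainTwoPoint`) this is
the tree's proved `pinnedVillainTwoPoint_mono` on the bond multigraph (loops and parallel edges,
present for `M = 1` or `L ≤ 2`, are allowed there).
[cite: AizenmanHarelPeledShapiro2021, Cor. 11.4] -/
theorem twoPoint_mono (Q : VillainCurrentModel d L M) (h : ∀ b, P.stiffness b ≤ Q.stiffness b)
    (x y : SpaceTimeSite d L M) : P.twoPoint x y ≤ Q.twoPoint x y := by
  rw [twoPoint_eq_ofReal_villainTwoPoint, twoPoint_eq_ofReal_villainTwoPoint]
  refine ENNReal.ofReal_le_ofReal ?_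
  have := pinnedVillainTwoPoint_mono (V := SpaceTimeSite d L M)
    (fun b : Bond d L M => some b.1) (fun b => some (b.1 + unitVec b.2)) P.stiffness_pos h
    (some x) (some y)
  simpa [villainTwoPoint, villainSpinWeight] using this

end VillainCurrentModel

end Literature.Probability.LatticeModels
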